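import Literature.MathematicalPhysics.QuantumFieldTheory.QCDTransferMatrix

/-!
# Kernel bounds for the Wilson pure-gauge transfer kernel: `K_β ≤ 1` and joint continuity
(crux `QuarksAsStableAction.StableActionBridge`, item stmt-QuantumFields-9737, line `Sketch`;
registered stubs `gaugeSliceKernel_le_one` and `continuous_gaugeSliceKernel` of the lead skeleton)

In temporal gauge the one-step transfer kernel of Wilson's `SU(3)` lattice gauge theory on the
spatial three-torus of side `S` is (Smit, *Introduction to Quantum Fields on a Lattice*, §4.6
(4.121)–(4.129); Lüscher, CMP 54 (1977) 283–292)

  `K_β(U, U') = exp(−(β/2) S₃(U)) · exp(−β ∑ₗ (3 − Re tr(U_l U'_lᴴ))) · exp(−(β/2) S₃(U'))`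

(`gaugeSliceKernel`, `S₃ = wilsonAction (fundamentalRep (Fin 3))` the Wilson action of the
spatial torus).  These are the two kernel-level inputs of "the integral operator `T̂_U` with
kernel `K_β` on `L²(SU(3)^{links}, Haar)` is bounded":

* `gaugeSliceKernel_le_one`: for `β ≥ 0`, `K_β(U, U') ≤ 1`.  Each of the three exponents is
  `≤ 0`: the Wilson action of unitary holonomies is `≥ 0` (every plaquette term is
  `3 − Re tr U_p ≥ 0` since `Re tr V ≤ 3` for unitary `V`, whose entries have norm `≤ 1`), and
  `Re tr(U_l U'_lᴴ) ≤ 3` because `U_l U'_lᴴ` is again unitary.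
* `continuous_gaugeSliceKernel`: `(U, U') ↦ K_β(U, U')` is jointly continuous (composition of
  `Real.exp`, the continuous Wilson action and finitely many matrix-entry polynomials), which the
  lead uses for measurability and integrability on the product of the two slices.

[cite: Smit2023, §4.6 (4.121)–(4.129)] [cite: Luscher1977, pp. 283–292]
-/

noncomputable section

open MeasureTheory Matrix Literature.MathematicalPhysics.QuantumFieldTheory
  Literature.MathematicalPhysics.QuantumLattice

namespace Summit.QuantumFields.QCD.Cruxes.StableActionBridge.Sketch

namespace GaugeKernelBounds

/-- `Re tr V ≤ 3` for a unitary `3 × 3` matrix (its entries have norm `≤ 1`). [folklore] -/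
theorem re_trace_le_three {V : Matrix (Fin 3) (Fin 3) ℂ}
    (hV : V ∈ Matrix.unitaryGroup (Fin 3) ℂ) : V.trace.re ≤ 3 := by
  rw [Matrix.trace, Complex.re_sum]
  calc ∑ i, (V.diag i).re ≤ ∑ _i : Fin 3, (1 : ℝ) :=
        Finset.sum_le_sum fun i _ =>
          (Complex.re_le_norm _).trans (entry_norm_bound_of_unitary hV i i)
    _ = 3 := by simp

/-- The Wilson action of `SU(3)` configurations (fundamental representation) is nonnegative:
every plaquette term `3 − Re tr U_p` is. [folklore] -/
theorem wilsonAction_fundamental_nonneg {S : ℕ} [NeZero S]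
    (U : GaugeConfig 3 S (Matrix.specialUnitaryGroup (Fin 3) ℂ)) :
    0 ≤ wilsonAction (fundamentalRep (Fin 3)) U := by
  unfold wilsonAction
  refine Finset.sum_nonneg fun p _ => sub_nonneg.2 ?_
  refine (re_trace_le_three (fundamentalRep_mem_unitaryGroup _)).trans_eq ?_
  norm_num

/-- For `V, W ∈ SU(3)`, `Re tr(V Wᴴ) ≤ 3` (`V Wᴴ` is unitary). [folklore] -/
theorem re_trace_mul_conjTranspose_le_three (V W : Matrix.specialUnitaryGroup (Fin 3) ℂ) :
    ((V : Matrix (Fin 3) (Fin 3) ℂ) * (W : Matrix (Fin 3) (Fin 3) ℂ)ᴴ).trace.re ≤ 3 := by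
  refine re_trace_le_three (mul_mem (Matrix.specialUnitaryGroup_le_unitaryGroup V.2) ?_)
  rw [← Matrix.star_eq_conjTranspose]
  exact Unitary.star_mem (Matrix.specialUnitaryGroup_le_unitaryGroup W.2)

/-- The temporal-plaquette sum `∑ₗ (3 − Re tr(U_l U'_lᴴ))` between two slices is nonnegative.
[folklore] -/
theorem linkSum_nonneg {S : ℕ} [NeZero S] (U U' : GaugeConfig 3 S (Matrix.specialUnitaryGroup (Fin 3) ℂ)) :
    0 ≤ ∑ l : Edge 3 S, ((3 : ℝ) -
      ((U l : Matrix (Fin 3) (Fin 3) ℂ) * (U' l : Matrix (Fin 3) (Fin 3) ℂ)ᴴ).trace.re) :=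
  Finset.sum_nonneg fun l _ => sub_nonneg.2 (re_trace_mul_conjTranspose_le_three (U l) (U' l))

/-- The Wilson action of the torus (fundamental representation of `SU(3)`) is continuous in the
configuration. [folklore] -/
theorem continuous_wilsonAction_fundamental {S : ℕ} [NeZero S] :
    Continuous fun U : GaugeConfig 3 S (Matrix.specialUnitaryGroup (Fin 3) ℂ) =>
      wilsonAction (fundamentalRep (Fin 3)) U := by
  unfold wilsonAction
  refine continuous_finsetSum _ fun p _ => ?_
  have h1 : Continuous fun U : GaugeConfig 3 S (Matrix.specialUnitaryGroup (Fin 3) ℂ) =>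
      plaquetteHolonomy U p.1 p.2.1.1 p.2.1.2 := by
    unfold plaquetteHolonomy; fun_prop
  have h2 : Continuous fun U : GaugeConfig 3 S (Matrix.specialUnitaryGroup (Fin 3) ℂ) =>
      (fundamentalRep (Fin 3) (plaquetteHolonomy U p.1 p.2.1.1 p.2.1.2)).trace.re :=
    Complex.continuous_re.comp ((continuous_fundamentalRep (Fin 3)).comp h1).matrix_trace
  exact continuous_const.sub h2

/-- The temporal-plaquette sum `∑ₗ (3 − Re tr(U_l U'_lᴴ))` is jointly continuous in `(U, U')`.
[folklore] -/
theorem continuous_linkSum {S : ℕ} [NeZero S] :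
    Continuous fun p : GaugeConfig 3 S (Matrix.specialUnitaryGroup (Fin 3) ℂ) ×
        GaugeConfig 3 S (Matrix.specialUnitaryGroup (Fin 3) ℂ) =>
      ∑ l : Edge 3 S, ((3 : ℝ) -
        ((p.1 l : Matrix (Fin 3) (Fin 3) ℂ) * (p.2 l : Matrix (Fin 3) (Fin 3) ℂ)ᴴ).trace.re) := by
  refine continuous_finsetSum _ fun l _ => continuous_const.sub ?_
  have hV : Continuous fun p : GaugeConfig 3 S (Matrix.specialUnitaryGroup (Fin 3) ℂ) ×
      GaugeConfig 3 S (Matrix.specialUnitaryGroup (Fin 3) ℂ) =>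
        (p.1 l : Matrix (Fin 3) (Fin 3) ℂ) := by
    fun_prop
  have hW : Continuous fun p : GaugeConfig 3 S (Matrix.specialUnitaryGroup (Fin 3) ℂ) ×
      GaugeConfig 3 S (Matrix.specialUnitaryGroup (Fin 3) ℂ) =>
        (p.2 l : Matrix (Fin 3) (Fin 3) ℂ) := by
    fun_prop
  exact Complex.continuous_re.comp (hV.matrix_mul hW.matrix_conjTranspose).matrix_trace

end GaugeKernelBounds

open GaugeKernelBounds

/-- **The Wilson transfer kernel is bounded by one** for `β ≥ 0`:
`K_β(U, U') ≤ 1`, since all three exponents `−(β/2)S₃(U)`, `−β∑ₗ(3 − Re tr(U_l U'_lᴴ))`,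
`−(β/2)S₃(U')` are `≤ 0`.  Kernel-level input of the boundedness of `T̂_U`.
[cite: Smit2023, §4.6 (4.121)–(4.129)] [cite: Luscher1977, pp. 283–292] -/
theorem gaugeSliceKernel_le_one : ∀ (S : ℕ) [NeZero S] (β : ℝ), 0 ≤ β → ∀ U U' : GaugeConfig 3 S (Matrix.specialUnitaryGroup (Fin 3) ℂ), gaugeSliceKernel β U U' ≤ 1 := by
  intro S _ β hβ U U'
  unfold gaugeSliceKernel
  have hβ2 : 0 ≤ β / 2 := by positivity
  have h1 : Real.exp (-(β / 2) * wilsonAction (fundamentalRep (Fin 3)) U) ≤ 1 :=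
    Real.exp_le_one_iff.2 (by
      rw [neg_mul]
      exact neg_nonpos.2 (mul_nonneg hβ2 (wilsonAction_fundamental_nonneg U)))
  have h2 : Real.exp (-(β * ∑ l : Edge 3 S, ((3 : ℝ) -
      ((U l : Matrix (Fin 3) (Fin 3) ℂ) * (U' l : Matrix (Fin 3) (Fin 3) ℂ)ᴴ).trace.re))) ≤ 1 :=
    Real.exp_le_one_iff.2 (neg_nonpos.2 (mul_nonneg hβ (linkSum_nonneg U U')))
  have h3 : Real.exp (-(β / 2) * wilsonAction (fundamentalRep (Fin 3)) U') ≤ 1 :=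
    Real.exp_le_one_iff.2 (by
      rw [neg_mul]
      exact neg_nonpos.2 (mul_nonneg hβ2 (wilsonAction_fundamental_nonneg U')))
  exact mul_le_one₀ (mul_le_one₀ h1 (Real.exp_nonneg _) h2) (Real.exp_nonneg _) h3

/-- **Joint continuity of the Wilson transfer kernel** `(U, U') ↦ K_β(U, U')` (composition of
`Real.exp`, the continuous Wilson action and finitely many matrix-entry polynomials); used for
measurability and integrability of `K_β` on the product of the two slices.
[cite: Smit2023, §4.6 (4.121)–(4.129)] [cite: Luscher1977, pp. 283–292] -/
theorem continuous_gaugeSliceKernel : ∀ (S : ℕ) [NeZero S] (β : ℝ), Continuous fun p : GaugeConfig 3 S (Matrix.specialUnitaryGroup (Fin 3) ℂ) × GaugeConfig 3 S (Matrix.specialUnitaryGroup (Fin 3) ℂ) => gaugeSliceKernel β p.1 p.2 := by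
  intro S _ β
  unfold gaugeSliceKernel
  have hS : Continuous fun U : GaugeConfig 3 S (Matrix.specialUnitaryGroup (Fin 3) ℂ) =>
      wilsonAction (fundamentalRep (Fin 3)) U := continuous_wilsonAction_fundamental
  refine ((Real.continuous_exp.comp (continuous_const.mul (hS.comp continuous_fst))).mul
    (Real.continuous_exp.comp (continuous_const.mul (continuous_linkSum (S := S))).neg)).mul
    (Real.continuous_exp.comp (continuous_const.mul (hS.comp continuous_snd)))

end Summit.QuantumFields.QCD.Cruxes.StableActionBridge.Sketch

end
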